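import Mathlib.Probability.Kernel.Composition.MeasureCompProd
import Literature.MathematicalPhysics.KineticTheory.InfiniteRotorGas
import Literature.Analysis.FunctionSpaces.PoissonMeckePrelims
import Literature.Dynamics.Hyperbolic.AnosovDie
import HarnessLib

/-!
# The next collision of a tagged sphere and the one-sphere Hopf property (H)

Topic `Literature/MathematicalPhysics/KineticTheory`; definition request D4 `defn-OneSphereHopfProperty`
of route `Summits/AtomisticToContinuum/HydrodynamicLimit/Theses/AnosovDiceHopf.lean` (consumers: the
informal cruxes `SpecularDiceHopf` — the true gas, die `F ≡ id` — and `OneSphereHopfToMaxwellian` —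
every die), on top of `InfiniteRotorGas.lean` (which deliberately left these out) and of Alexander's
unmarked flow `Literature/Analysis/FluidPDE/InfiniteHardSphereFlow.lean`.

## Contents

* (generic, namespace `TaggedParticle`; a family of particle paths `x p : ℝ → V × M` labelled by the
  points `p` of a set `S`, positions `(x p t).1 ∈ V`) the collision times `collisionTimes ε S x p` of
  the particle `p` (so that `(p, t) ∈ collisionEvents ε S x ↔ p ∈ S ∧ t ∈ collisionTimes ε S x p` for
  both the unmarked and the rotor gas, `Iff.rfl`), `HasNextCollision` (some collision at a time
  `> 0`), the NEXT COLLISION TIME `nextCollisionTime` (infimum of the collision times `> 0`; attained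
  as soon as the collision times of `p` are locally finite, `nextCollisionTime_mem`; as an element
  `τ⁺` of `ℝ ∪ {⊤}`, `⊤` if none: `nextCollisionTimeTop`, `nextCollisionTimeTop_lt_top_iff`), the PARTNER
  `nextPartner`, the unit CONTACT NORMAL `nextNormal = ε⁻¹ (x_p - x_q)` (pointing towards `p`), the
  OUTGOING RELATIVE VELOCITY `nextRelVel = v_p(τ) - v_q(τ)` (velocities are right-continuous in the
  tree's trajectories, so the values at the collision instant are post-collisional) and the OUTGOING
  LAMBERT POINT `nextLambertPoint = lambertPoint n g⁺ ∈ ℝ²`, the Lambert projection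
  (`DicedHardSphereDynamics`: `Λ_n` forgets the normal component) of `p`'s outgoing relative
  direction over its outgoing hemisphere `{⟪·, n⟫ > 0}`; and "EVERYTHING ELSE" seen from `p`:
  `everythingElse vel (ω, p) = (ω ∖ {p}, x_p, ‖v_p‖)` — the states of all other particles (with
  their marks: velocities, rotors), `p`'s position and `p`'s speed, NOT `p`'s velocity direction and
  NOT `p`'s own further marks (rotor).
* (generic, namespace `PointProcess`) the CAMPBELL MEASURE `campbellMeasure μ = μ ⊗ₘ countKernel`,
  `C(dω, dp) = μ(dω) ω(dp)` on `PointConfig X × X` ("a typical particle of a `μ`-typical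
  configuration"; the tree's s-finite counting kernel `PointConfig.countKernel`), and the predicate
  `HasAbsContOutcome μ E A O ν`: for typical particles in the event `A`, the outcome `O` is
  absolutely continuous with respect to `ν` CONDITIONALLY ON `E` — stated product-wise, "the joint
  law of `(E, O)` on `A` is `≪ (law of E) ⊗ ν`", i.e. every measurable `S` with
  `((C.map E) ⊗ ν)(S) = 0` has `C(A ∩ (E, O)⁻¹ S) = 0` (outer measure: no measurability of `O` is
  presupposed; for measurable data it is literally `(C|_A).map (E, O) ≪ (C.map E) ⊗ ν`,
  `hasAbsContOutcome_iff_map`). When conditional laws exist this is "for `law(E)`-a.e. value `e`, the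
  conditional law of `O` given `E = e` (on `A`) is `≪ ν`"; the product form needs no disintegration.
* THE ONE-SPHERE HOPF PROPERTY (H) of a law `μ` under a flow `Φ`:
  `RotorGas.InfiniteDicedFlow.HasOneSphereHopfProperty Φ μ` (rotor gas `HS_rot(Ω, D)`, any die) and
  `InfiniteHardSphereFlow.HasOneSphereHopfProperty Φ μ` (the true gas in `ℝ³`): for a `μ`-typical
  configuration `ω` and a typical particle `p ∈ ω` that collides again after time `0`, conditionally
  on everything else `(ω ∖ {p}, x_p, ‖v_p‖)` the law of the outgoing Lambert point of `p`'s next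
  collision is absolutely continuous with respect to Lebesgue (area) measure on the closed unit
  Lambert disc (`TaggedParticle.lambertDiscMeasure`; the outcome lives there,
  `norm_nextLambertPoint_le_one`; equivalently the outgoing relative direction is a.c. with respect
  to the flux (Knudsen cosine) measure of the outgoing hemisphere, which `Λ_n` pushes to area on the
  disc) — with the flow-specific next-collision data
  `Φ.HasNextCollision / nextCollisionTime / nextPartner / nextLambertPoint ω p` along `Φ.traj ω`;
  `hasOneSphereHopfProperty_iff_map`: with measurable next-collision data it is Mathlib's
  `(C|_{τ⁺<⊤}).map (everything else, outcome) ≪ (C.map everything else) ⊗ Leb_disc`; and for the true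
  gas `nextLambertPoint_eq_incoming`: the outgoing Lambert point is the Lambert point of the
  INCOMING relative velocity (Lambert's projection does not see the elastic reflection), so (H) for
  `F ≡ id` is a statement about the impact geometry of the next collision.
* `RotorGas.IsOVYLimitStateMicro` (scaling note (4) of the request): OVY limit states of the torus
  rotor gases run at torus rotor speed `Ω / ε_N` (microscopic speed `Ω`), the clause the typed items
  `RotorGasMacroErgodic` / `RotorGasEulerLimit` inline (`isOVYLimitStateMicro_iff`, `Iff.rfl`).
* `AnosovDie.toRotorDie D = ⟨D.m, D.flow, D.die, D.rev⟩` (the rotor-die data the items of the route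
  inline as `Dr = ⟨…⟩`), `rfl` lemmas and `toRotorDie_isReversible`.
* API: attainment and minimality of the next collision time under local finiteness of the collision
  times, which holds along both flows (`finite_collisionTimes_inter_Icc`); the partner is a genuine
  other particle in contact; `‖nextNormal‖ = 1`, `‖nextLambertPoint‖ ≤ 1`; measurability of
  `everythingElse` (so that `law(E)` is a genuine push-forward, not junk); monotonicity of
  `HasAbsContOutcome` in the event and under coarsening of the conditioning; the empty state has (H).

## Design choices

* CONDITIONING AS REQUESTED. D4: "everything else = all other particles' states, p's position, speed
  and (for dice) the other rotors". So `everythingElse` keeps the partner's full state INCLUDING ITS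
  ROTOR and drops only `p`'s velocity direction and `p`'s rotor. A coarser conditioning gives a
  weaker property (`HasAbsContOutcome.comp_measurable`); a PAIR-BLIND variant (both rotors of the
  colliding pair free — what pair-plaque submersivity `AnosovDie.IsPairPlaqueSubmersive` pushes
  forward to) is not requested and not defined here; it is another instance of `HasAbsContOutcome`.
* Particles with no collision after time `0` impose nothing ((H) is about the NEXT collision when
  there is one); "a.s. every sphere collides infinitely often" is the separate standing hypothesis
  `InfiniteDicedFlow.CollidesInfinitelyOften` of `InfiniteRotorGas.lean`.
* The Campbell measure is infinite (but s-finite) for translation-invariant `μ`; (H) is an absolute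
  continuity statement and needs no normalisation and NO WINDOW: since `p`'s position is a
  coordinate of "everything else", the window-free statement is equivalent to the request's
  "typical particle in a bounded window" form for every window at once (restrict both sides to
  `{x_p ∈ B}` = `E⁻¹{e | e.2.1 ∈ B}`; conversely exhaust `ℝ³` by countably many windows).
  `campbellMeasure` is Mathlib's `Measure.compProd`, hence the junk value `0` if `μ` is not s-finite
  (all intended `μ` are probability laws: `RegularStationaryState`).
* `traj` carries no measurability axiom in either flow structure, so measurability of the
  next-collision maps in `(ω, p)` is not provable from the structures and is not claimed; the
  definition of (H) does not need it (outer measure), and `everythingElse`, whose push-forward law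
  enters (H), IS measurable (`measurable_everythingElse`).
* Junk values: `nextCollisionTime = 0` and `nextPartner = p` (so `nextNormal = 0`) when `p` has no
  collision after time `0`; `lambertPoint` of a zero normal is junk. All statements about these maps
  assume `HasNextCollision`.
* Frames: the Lambert point is read in the tree's measurable frame `Lambert.e₁/e₂` at the normal
  pointing towards the tagged particle; another frame changes `nextLambertPoint` by a measurably
  varying isometry of the disc, which does not affect (H).

## References

* K. Burns, A. Wilkinson, *On the ergodicity of partially hyperbolic systems*, Ann. of Math. 171
  (2010) 451–489 (the Hopf argument); M. Brin, Ja. Pesin, Math. USSR-Izv. 8 (1974) 177–218.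
* S. Olla, S. R. S. Varadhan, H.-T. Yau, *Hydrodynamical limit for a Hamiltonian system with weak
  noise*, Comm. Math. Phys. 155 (1993) 523–560, §4 (B) (the ergodic step the property replaces).
* G. Last, M. Penrose, *Lectures on the Poisson Process* (2017), §2.2 and Ch. 9 (Campbell measure,
  Palm distributions: "typical point").
* The model and the request: route `AnosovDiceHopf` (D4), `InfiniteRotorGas.lean`,
  `DicedHardSphereDynamics.lean`, `AnosovDie.lean`.
-/

noncomputable section

open MeasureTheory ProbabilityTheory Set Filter Function Metric
open scoped ENNReal NNReal Topology InnerProductSpace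
open Literature.Analysis.FunctionSpaces Literature.Analysis.FluidPDE

namespace Literature.MathematicalPhysics.KineticTheory

/-! ## The next collision of a tagged particle along a family of paths -/

namespace TaggedParticle

section Times

variable {V : Type*} [NormedAddCommGroup V] {M : Type*}

/-- The COLLISION TIMES of the particle labelled `p` along the family of paths `x q : ℝ → V × M`,
`q ∈ S` (positions `(x q t).1`, spheres of diameter `ε`): the times at which `p` touches another
particle of `S`, `‖x_p(t) - x_q(t)‖ = ε`, `q ∈ S`, `q ≠ p` (the time-section at `p` of the tree's
`collisionEvents`). [folklore] -/
def collisionTimes (ε : ℝ) (S : Set (V × M)) (x : V × M → ℝ → V × M) (p : V × M) : Set ℝ :=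
  {t | ∃ q ∈ S, q ≠ p ∧ ‖(x p t).1 - (x q t).1‖ = ε}

variable {ε : ℝ} {S : Set (V × M)} {x : V × M → ℝ → V × M} {p : V × M}

/-- Membership in the set of collision times. [folklore] -/
theorem mem_collisionTimes {t : ℝ} :
    t ∈ collisionTimes ε S x p ↔ ∃ q ∈ S, q ≠ p ∧ ‖(x p t).1 - (x q t).1‖ = ε :=
  Iff.rfl

/-- The particle `p` HAS A NEXT COLLISION: it touches another particle at some time `t > 0`.
[folklore] -/
def HasNextCollision (ε : ℝ) (S : Set (V × M)) (x : V × M → ℝ → V × M) (p : V × M) : Prop :=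
  (collisionTimes ε S x p ∩ Ioi 0).Nonempty

variable (ε S x p) in
/-- The NEXT COLLISION TIME of `p` after time `0`: the infimum of its collision times `t > 0` (junk
`0` if there is none; attained when the collision times are locally finite,
`nextCollisionTime_mem`). [folklore] -/
def nextCollisionTime : ℝ :=
  sInf (collisionTimes ε S x p ∩ Ioi 0)

/-- The next collision time is not larger than any collision time `t > 0`. [folklore] -/
theorem nextCollisionTime_le {t : ℝ} (ht : t ∈ collisionTimes ε S x p) (ht0 : 0 < t) :
    nextCollisionTime ε S x p ≤ t :=
  csInf_le ⟨0, fun _ hs => le_of_lt hs.2⟩ ⟨ht, ht0⟩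

/-- The next collision time is nonnegative. [folklore] -/
theorem nextCollisionTime_nonneg : 0 ≤ nextCollisionTime ε S x p := by
  by_cases h : (collisionTimes ε S x p ∩ Ioi 0).Nonempty
  · exact le_csInf h fun _ hs => le_of_lt hs.2
  · rw [nextCollisionTime, Set.not_nonempty_iff_eq_empty.1 h, Real.sInf_empty]

/-- If the collision times of `p` in every interval `(0, b]` are finitely many (true along
hard-sphere trajectories, `finite_collisionTimes_inter_Ioc` below) and `p` has a next collision,
then the next collision time IS a collision time and is positive. [folklore] -/
theorem nextCollisionTime_mem (hfin : ∀ b, (collisionTimes ε S x p ∩ Ioc 0 b).Finite)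
    (h : HasNextCollision ε S x p) :
    nextCollisionTime ε S x p ∈ collisionTimes ε S x p ∩ Ioi 0 := by
  obtain ⟨t₀, ht₀⟩ := h
  have hF : (collisionTimes ε S x p ∩ Ioc 0 t₀).Finite := hfin t₀
  have hne : (collisionTimes ε S x p ∩ Ioc 0 t₀).Nonempty := ⟨t₀, ht₀.1, ht₀.2, le_rfl⟩
  obtain ⟨m, ⟨hmT, hm0, hmt₀⟩, hmin⟩ := Set.exists_min_image _ id hF hne
  have hleast : IsLeast (collisionTimes ε S x p ∩ Ioi 0) m := by
    refine ⟨⟨hmT, hm0⟩, fun t ht => ?_⟩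
    by_cases htt : t ≤ t₀
    · exact hmin t ⟨ht.1, ht.2, htt⟩
    · exact hmt₀.trans (le_of_lt (not_le.1 htt))
  rw [nextCollisionTime, hleast.csInf_eq]
  exact ⟨hmT, hm0⟩

/-- Under local finiteness, the next collision time of a particle with a next collision is positive.
[folklore] -/
theorem nextCollisionTime_pos (hfin : ∀ b, (collisionTimes ε S x p ∩ Ioc 0 b).Finite)
    (h : HasNextCollision ε S x p) : 0 < nextCollisionTime ε S x p :=
  (nextCollisionTime_mem hfin h).2

/-- No collision of `p` occurs strictly between time `0` and its next collision time. [folklore] -/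
theorem not_mem_collisionTimes_of_lt {t : ℝ} (ht0 : 0 < t) (ht : t < nextCollisionTime ε S x p) :
    t ∉ collisionTimes ε S x p :=
  fun htc => absurd (nextCollisionTime_le htc ht0) (not_le.2 ht)

open Classical in
variable (ε S x p) in
/-- The next collision time as an element `τ⁺ ∈ ℝ ∪ {⊤}`: `⊤` when `p` has no collision after time
`0` (the request's "`inf {t > 0 | (p, t) ∈ collisionEvents}`, `⊤` if none"). [folklore] -/
def nextCollisionTimeTop : WithTop ℝ :=
  if HasNextCollision ε S x p then (nextCollisionTime ε S x p : WithTop ℝ) else ⊤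

/-- With a next collision, `τ⁺` is the (real) next collision time. [folklore] -/
theorem nextCollisionTimeTop_of_hasNextCollision (h : HasNextCollision ε S x p) :
    nextCollisionTimeTop ε S x p = nextCollisionTime ε S x p :=
  if_pos h

/-- Without a next collision, `τ⁺ = ⊤`. [folklore] -/
theorem nextCollisionTimeTop_of_not_hasNextCollision (h : ¬ HasNextCollision ε S x p) :
    nextCollisionTimeTop ε S x p = ⊤ :=
  if_neg h

/-- `τ⁺ < ⊤` iff `p` has a next collision. [folklore] -/
theorem nextCollisionTimeTop_lt_top_iff :
    nextCollisionTimeTop ε S x p < ⊤ ↔ HasNextCollision ε S x p := by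
  by_cases h : HasNextCollision ε S x p
  · simp only [nextCollisionTimeTop_of_hasNextCollision h, WithTop.coe_lt_top, h]
  · simp only [nextCollisionTimeTop_of_not_hasNextCollision h, lt_self_iff_false, h]

open Classical in
variable (ε S x p) in
/-- The PARTNER of `p`'s next collision: a particle `q ∈ S`, `q ≠ p`, in contact with `p` at the next
collision time (unique along hard-sphere trajectories, whose collisions are pairwise; junk `p` if
`p` has no next collision). [folklore] -/
def nextPartner : V × M :=
  if h : ∃ q ∈ S, q ≠ p ∧ ‖(x p (nextCollisionTime ε S x p)).1 -
      (x q (nextCollisionTime ε S x p)).1‖ = ε then h.choose else p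

/-- The partner is another particle of `S` in contact with `p` at the next collision time.
[folklore] -/
theorem nextPartner_spec (hfin : ∀ b, (collisionTimes ε S x p ∩ Ioc 0 b).Finite)
    (h : HasNextCollision ε S x p) :
    nextPartner ε S x p ∈ S ∧ nextPartner ε S x p ≠ p ∧
      ‖(x p (nextCollisionTime ε S x p)).1 -
        (x (nextPartner ε S x p) (nextCollisionTime ε S x p)).1‖ = ε := by
  have hex : ∃ q ∈ S, q ≠ p ∧ ‖(x p (nextCollisionTime ε S x p)).1 -
      (x q (nextCollisionTime ε S x p)).1‖ = ε := (nextCollisionTime_mem hfin h).1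
  rw [nextPartner, dif_pos hex]
  exact hex.choose_spec

/-- Along trajectories with pairwise collisions the partner is THE particle in contact: any
`q' ∈ S`, `q' ≠ p`, touching `p` at the next collision time is the partner. [folklore] -/
theorem eq_nextPartner (hfin : ∀ b, (collisionTimes ε S x p ∩ Ioc 0 b).Finite)
    (h : HasNextCollision ε S x p)
    (huniq : ∀ t, ∀ q ∈ S, q ≠ p → ‖(x p t).1 - (x q t).1‖ = ε →
      ∀ q' ∈ S, q' ≠ p → ‖(x p t).1 - (x q' t).1‖ = ε → q' = q)
    {q' : V × M} (hq'S : q' ∈ S) (hq'p : q' ≠ p)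
    (hq' : ‖(x p (nextCollisionTime ε S x p)).1 - (x q' (nextCollisionTime ε S x p)).1‖ = ε) :
    q' = nextPartner ε S x p := by
  obtain ⟨hqS, hqp, hq⟩ := nextPartner_spec hfin h
  exact huniq _ _ hqS hqp hq q' hq'S hq'p hq'

variable [NormedSpace ℝ V]

variable (ε S x p) in
/-- The unit CONTACT NORMAL of `p`'s next collision, pointing from the partner towards `p`:
`n = ε⁻¹ (x_p(τ) - x_q(τ))` (so `p`'s outgoing hemisphere is `{⟪·, n⟫ > 0}`; junk `0` without a next
collision). [folklore] -/
def nextNormal : V :=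
  ε⁻¹ • ((x p (nextCollisionTime ε S x p)).1 -
    (x (nextPartner ε S x p) (nextCollisionTime ε S x p)).1)

/-- The contact normal of a next collision is a unit vector. [folklore] -/
theorem norm_nextNormal (hfin : ∀ b, (collisionTimes ε S x p ∩ Ioc 0 b).Finite)
    (h : HasNextCollision ε S x p) (hε : 0 < ε) : ‖nextNormal ε S x p‖ = 1 := by
  rw [nextNormal, norm_smul, norm_inv, Real.norm_eq_abs, abs_of_pos hε,
    (nextPartner_spec hfin h).2.2, inv_mul_cancel₀ hε.ne']

variable (ε S x p) in
/-- The OUTGOING RELATIVE VELOCITY of `p`'s next collision, `g⁺ = v_p(τ) - v_q(τ)`, read through the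
velocity readout `vel` of the mark (velocities of the tree's trajectories are right-continuous, so
the values at the collision instant `τ` are the post-collisional ones). [folklore] -/
def nextRelVel (vel : M → V) : V :=
  vel (x p (nextCollisionTime ε S x p)).2 - vel (x (nextPartner ε S x p) (nextCollisionTime ε S x p)).2

end Times

section Lambert

local notation "E²" => EuclideanSpace ℝ (Fin 2)
local notation "E³" => EuclideanSpace ℝ (Fin 3)

variable {M : Type*}

/-- Lebesgue (area) measure on the closed unit LAMBERT DISC `{q ∈ ℝ² | ‖q‖ ≤ 1}` — the image of
the flux (Knudsen cosine) measure `⟪n, ·⟫ dσ` of the outgoing hemisphere under Lambert's projection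
`Λ_n` (`DicedHardSphereDynamics`); the reference measure of property (H). It has the same null sets
as Lebesgue measure on the open disc (the circle is null). [folklore] -/
def lambertDiscMeasure : Measure E² :=
  volume.restrict (closedBall (0 : E²) 1)

/-- Unfolding lemma for `lambertDiscMeasure`. [folklore] -/
theorem lambertDiscMeasure_eq : lambertDiscMeasure = volume.restrict (closedBall (0 : E²) 1) := rfl

/-- The Lambert disc has finite area. [folklore] -/
instance isFiniteMeasure_lambertDiscMeasure : IsFiniteMeasure lambertDiscMeasure := by
  rw [lambertDiscMeasure_eq]
  exact ⟨by
    rw [Measure.restrict_apply_univ]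
    exact (isCompact_closedBall (0 : E²) 1).measure_lt_top⟩

/-- The OUTGOING LAMBERT POINT of `p`'s next collision: the Lambert projection `Λ_n(ĝ⁺)` of the
outgoing relative direction `ĝ⁺ = g⁺/‖g⁺‖` over `p`'s outgoing hemisphere onto the unit disc of
`n^⊥ ≅ ℝ²` (`lambertPoint n g⁺ = coords n g⁺ / ‖g⁺‖`; for the diced rule with `p` leading this is
the die value `D.F θ_p θ_q` at the incoming Lambert point, `DicedHardSphereDynamics`). [folklore] -/
def nextLambertPoint (ε : ℝ) (S : Set (E³ × M)) (x : E³ × M → ℝ → E³ × M) (vel : M → E³)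
    (p : E³ × M) : E² :=
  lambertPoint (nextNormal ε S x p) (nextRelVel ε S x p vel)

/-- The outgoing Lambert point of a next collision lies in the closed unit disc. [folklore] -/
theorem norm_nextLambertPoint_le_one {ε : ℝ} {S : Set (E³ × M)} {x : E³ × M → ℝ → E³ × M}
    (vel : M → E³) {p : E³ × M} (hfin : ∀ b, (collisionTimes ε S x p ∩ Ioc 0 b).Finite)
    (h : HasNextCollision ε S x p) (hε : 0 < ε) : ‖nextLambertPoint ε S x vel p‖ ≤ 1 :=
  norm_lambertPoint_le_one (norm_nextNormal hfin h hε) _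

end Lambert

/-! ### Everything else, seen from a tagged particle -/

section EverythingElse

variable {V : Type*} [TopologicalSpace V] {M : Type*} [TopologicalSpace M] {W : Type*}
  [NormedAddCommGroup W]

/-- EVERYTHING ELSE seen from the tagged particle `p = (x_p, m_p)` of the configuration `ω`: the
configuration of all OTHER particles with their full marks, `p`'s position and `p`'s speed
`‖vel m_p‖` — i.e. all of `(ω, p)` but `p`'s velocity direction and `p`'s further marks (its
rotor) (request D4: "all other particles' states, p's position, speed and (for dice) the other
rotors"). [folklore] -/
def everythingElse (vel : M → W) (z : PointConfig (V × M) × (V × M)) :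
    PointConfig (V × M) × V × ℝ :=
  (z.1.restrict {z.2}ᶜ, z.2.1, ‖vel z.2.2‖)

/-- Unfolding lemma for `everythingElse`. [folklore] -/
@[simp]
theorem everythingElse_apply (vel : M → W) (ω : PointConfig (V × M)) (p : V × M) :
    everythingElse vel (ω, p) = (ω.restrict {p}ᶜ, p.1, ‖vel p.2‖) :=
  rfl

/-- The other particles: a point lies in `ω ∖ {p}` iff it is a point of `ω` other than `p`.
[folklore] -/
theorem mem_everythingElse_fst {vel : M → W} {z : PointConfig (V × M) × (V × M)} {q : V × M} :
    q ∈ (everythingElse vel z).1 ↔ q ∈ z.1 ∧ q ≠ z.2 := by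
  change q ∈ z.1.carrier ∩ {z.2}ᶜ ↔ _
  rw [mem_inter_iff, mem_compl_singleton_iff]
  rfl

end EverythingElse

end TaggedParticle

/-! ## Removing a point, the Campbell measure, conditional absolute continuity of an outcome -/

namespace PointProcess

section Erase

variable {X : Type*} [TopologicalSpace X]

/-- Counting after removing the point `p`: `N_{ω ∖ {p}}(s) = N_ω(s) - 1` if `p ∈ ω ∩ s`, else
`N_ω(s)`. [folklore] -/
theorem count_restrict_compl_singleton (ω : PointConfig X) (p : X) (s : Set X)
    [Decidable (p ∈ ω ∧ p ∈ s)] :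
    (ω.restrict {p}ᶜ).count s = if p ∈ ω ∧ p ∈ s then ω.count s - 1 else ω.count s := by
  rw [PointConfig.count_restrict]
  simp only [PointConfig.count]
  have hset : ω.carrier ∩ ({p}ᶜ ∩ s) = (ω.carrier ∩ s) \ {p} := by
    ext q
    simp only [mem_inter_iff, mem_compl_iff, mem_singleton_iff, Set.mem_sdiff]
    tauto
  rw [hset]
  split_ifs with h
  · have hp : p ∈ ω.carrier ∩ s := ⟨h.1, h.2⟩
    exact (ENat.addLECancellable_of_ne_top (ENat.coe_ne_top 1)).eq_tsub_of_add_eq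
      (Set.encard_sdiff_singleton_add_one hp)
  · rw [Set.sdiff_singleton_eq_self fun hp => h ⟨hp.1, hp.2⟩]

variable [MeasurableSpace X] [T2Space X] [SecondCountableTopology X] [OpensMeasurableSpace X]

/-- **Removing the tagged point is jointly measurable**: `(ω, p) ↦ ω ∖ {p}` is measurable for the
count σ-algebra (its counting maps are `N_ω(s) - 1{p ∈ ω ∩ s}`, measurable by the tree's joint
measurability of membership `PointConfig.measurableSet_mem`). [folklore] -/
theorem measurable_restrict_compl_singleton :
    Measurable fun z : PointConfig X × X => z.1.restrict {z.2}ᶜ := by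
  classical
  refine PointConfig.measurable_of_count fun s hs => ?_
  simp_rw [count_restrict_compl_singleton]
  have hmem : MeasurableSet {z : PointConfig X × X | z.2 ∈ z.1 ∧ z.2 ∈ s} :=
    (PointConfig.measurableSet_mem.preimage (measurable_snd.prodMk measurable_fst)).inter
      (hs.preimage measurable_snd)
  refine Measurable.ite hmem ?_ ((PointConfig.measurable_count hs).comp measurable_fst)
  exact (measurable_from_top (f := fun n : ℕ∞ => n - 1)).comp
    ((PointConfig.measurable_count hs).comp measurable_fst)

end Erase

section EverythingElseMeasurable

variable {V : Type*} [TopologicalSpace V] [MeasurableSpace V] {M : Type*} [TopologicalSpace M]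
  [MeasurableSpace M] {W : Type*} [NormedAddCommGroup W] [MeasurableSpace W]
  [OpensMeasurableSpace W]
  [T2Space (V × M)] [SecondCountableTopology (V × M)] [OpensMeasurableSpace (V × M)]

/-- **`everythingElse` is jointly measurable in `(ω, p)`** for a measurable velocity readout (so its
law under the Campbell measure is a genuine push-forward). [folklore] -/
theorem measurable_everythingElse {vel : M → W} (hvel : Measurable vel) :
    Measurable (TaggedParticle.everythingElse (V := V) vel) :=
  measurable_restrict_compl_singleton.prodMk
    (measurable_snd.fst.prodMk (hvel.comp measurable_snd.snd).norm)

end EverythingElseMeasurable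

section Campbell

variable {X : Type*} [TopologicalSpace X] [MeasurableSpace X] [MeasurableSingletonClass X]
  [SigmaCompactSpace X]

/-- The CAMPBELL MEASURE of a law `μ` on configurations: `C(dω, dp) = μ(dω) ω(dp)` on
`PointConfig X × X`, i.e. `C(B) = E_μ[#{p ∈ ω | (ω, p) ∈ B}]` — "a typical point of a typical
configuration" (Mathlib's `μ ⊗ₘ κ` with the tree's counting kernel `PointConfig.countKernel`;
Last–Penrose 2017 §2.2, (4.13), Ch. 9). [cite: LastPenrose2017, §2.2] -/
def campbellMeasure (μ : Measure (PointConfig X)) : Measure (PointConfig X × X) :=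
  μ ⊗ₘ PointConfig.countKernel

/-- The Campbell measure is s-finite (Mathlib's `compProd` always is). [folklore] -/
instance sFinite_campbellMeasure (μ : Measure (PointConfig X)) : SFinite (campbellMeasure μ) := by
  rw [campbellMeasure]
  infer_instance

variable [T2Space X] [OpensMeasurableSpace X]

/-- The Campbell measure of a measurable set: `C(B) = ∫ #{p ∈ ω | (ω, p) ∈ B} μ(dω)`. [folklore] -/
theorem campbellMeasure_apply (μ : Measure (PointConfig X)) [SFinite μ] {B : Set (PointConfig X × X)}
    (hB : MeasurableSet B) :
    campbellMeasure μ B = ∫⁻ ω, ω.toMeasure (Prod.mk ω ⁻¹' B) ∂μ := by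
  rw [campbellMeasure, Measure.compProd_apply hB]
  rfl

/-- Campbell's formula: `∫ f dC = ∫ ∑_{p ∈ ω} f(ω, p) μ(dω)` for measurable `f ≥ 0`. [folklore] -/
theorem lintegral_campbellMeasure (μ : Measure (PointConfig X)) [SFinite μ]
    {f : PointConfig X × X → ℝ≥0∞} (hf : Measurable f) :
    ∫⁻ z, f z ∂campbellMeasure μ = ∫⁻ ω, ∑' p : (ω : Set X), f (ω, p) ∂μ := by
  rw [campbellMeasure, Measure.lintegral_compProd hf]
  refine lintegral_congr fun ω => ?_
  rw [PointConfig.countKernel_apply, PointConfig.lintegral_toMeasure]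

/-- The Campbell measure of the empty state vanishes (no particle at all). [folklore] -/
theorem campbellMeasure_dirac_empty :
    campbellMeasure (Measure.dirac (∅ : PointConfig X)) = 0 := by
  rw [← Measure.measure_univ_eq_zero, campbellMeasure_apply _ MeasurableSet.univ]
  simp only [Set.preimage_univ]
  rw [lintegral_dirac']
  · simp [PointConfig.toMeasure_empty]
  · exact (PointConfig.countKernel (E := X)).measurable_coe MeasurableSet.univ

omit [T2Space X] [OpensMeasurableSpace X] in
/-- **Conditional absolute continuity of an outcome for typical particles.** For a law `μ` on
configurations, a conditioning map `E` ("everything else"), an event `A` (the particles concerned),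
an outcome `O` with values in a space carrying the reference measure `ν`:
for every measurable `S` with `((C.map E) ⊗ ν)(S) = 0` one has `C(A ∩ (E, O)⁻¹ S) = 0`, `C` the
Campbell measure — the joint law of `(E, O)` over the typical particles in `A` is absolutely
continuous with respect to `law(E) ⊗ ν`; when a disintegration exists: for `law(E)`-a.e. `e` the
conditional law of `O` given `E = e` is `≪ ν`. Outer-measure form (no measurability of `O`
presupposed; `hasAbsContOutcome_iff_map` for measurable data). [folklore] -/
def HasAbsContOutcome {β γ : Type*} [MeasurableSpace β] [MeasurableSpace γ]
    (μ : Measure (PointConfig X)) (E : PointConfig X × X → β) (A : Set (PointConfig X × X))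
    (O : PointConfig X × X → γ) (ν : Measure γ) : Prop :=
  ∀ S : Set (β × γ), MeasurableSet S → ((campbellMeasure μ).map E).prod ν S = 0 →
    campbellMeasure μ (A ∩ (fun z => (E z, O z)) ⁻¹' S) = 0

variable {β γ : Type*} [MeasurableSpace β] [MeasurableSpace γ] {μ : Measure (PointConfig X)}
  {E : PointConfig X × X → β} {A : Set (PointConfig X × X)} {O : PointConfig X × X → γ}
  {ν : Measure γ}

omit [T2Space X] [OpensMeasurableSpace X] in
/-- Fewer particles concerned, weaker requirement. [folklore] -/
theorem HasAbsContOutcome.mono (h : HasAbsContOutcome μ E A O ν) {A' : Set (PointConfig X × X)}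
    (hA' : A' ⊆ A) : HasAbsContOutcome μ E A' O ν :=
  fun S hS h0 => measure_mono_null (inter_subset_inter_left _ hA') (h S hS h0)

omit [T2Space X] [OpensMeasurableSpace X] in
/-- If the Campbell measure does not charge `A` (e.g. no particle ever collides), the requirement
is void. [folklore] -/
theorem hasAbsContOutcome_of_null (hA : campbellMeasure μ A = 0) : HasAbsContOutcome μ E A O ν :=
  fun _ _ _ => measure_mono_null inter_subset_left hA

omit [T2Space X] [OpensMeasurableSpace X] in
/-- For measurable data the property is literally "`(C|_A).map (E, O) ≪ (C.map E) ⊗ ν`".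
[folklore] -/
theorem hasAbsContOutcome_iff_map (hE : Measurable E) (hO : Measurable O) :
    HasAbsContOutcome μ E A O ν ↔
      ((campbellMeasure μ).restrict A).map (fun z => (E z, O z)) ≪
        ((campbellMeasure μ).map E).prod ν := by
  have hEO : Measurable fun z => (E z, O z) := hE.prodMk hO
  constructor
  · intro h
    refine Measure.AbsolutelyContinuous.mk fun S hS h0 => ?_
    rw [Measure.map_apply hEO hS, Measure.restrict_apply (hEO hS), inter_comm]
    exact h S hS h0
  · intro h S hS h0
    have := h h0
    rwa [Measure.map_apply hEO hS, Measure.restrict_apply (hEO hS), inter_comm] at this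

omit [T2Space X] [OpensMeasurableSpace X] in
/-- **Coarser conditioning, weaker property**: if the outcome is conditionally a.c. given `E`, it
is conditionally a.c. given any measurable function `f ∘ E` of `E`. [folklore] -/
theorem HasAbsContOutcome.comp_measurable [SFinite μ] [SFinite ν] (h : HasAbsContOutcome μ E A O ν)
    (hE : Measurable E) {β' : Type*} [MeasurableSpace β'] {f : β → β'} (hf : Measurable f) :
    HasAbsContOutcome μ (f ∘ E) A O ν := by
  intro S hS h0
  have hmap : ((campbellMeasure μ).map E).prod ν ((Prod.map f id) ⁻¹' S) = 0 := by
    rw [← Measure.map_apply (hf.prodMap measurable_id) hS, ← Measure.map_prod_map _ _ hf measurable_id,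
      Measure.map_map hf hE, Measure.map_id]
    exact h0
  exact h _ (hS.preimage (hf.prodMap measurable_id)) hmap

end Campbell

end PointProcess

/-! ## The one-sphere Hopf property of the rotor gas -/

namespace RotorGas

/-! ### OVY limit states at microscopic rotor speed (scaling note (4) of the request) -/

section OVYMicro

variable {K : Type*} [MeasurableSpace K] [TopologicalSpace K]

/-- **OVY limit states of the rotor gas at MICROSCOPIC rotor speed `Ω`**: as `RotorGas.IsOVYLimitState`,
but the `N`-th torus gas `HS_rot` runs its rotors at TORUS speed `Ω / ε_N`, `ε_N = hsDiameter σ N`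
(so that a rotor turns `O(1)` per mean free time and the blown-up limit dynamics is
`InfiniteDicedFlow 1 D Ω` with `Ω > 0`, not frozen rotors): `μ` is a vague cluster point, through
Laplace functionals of continuous compactly supported `f ≥ 0` along a subsequence, of the space-time
averaged blown-up laws — the clause the typed items `RotorGasMacroErgodic` / `RotorGasEulerLimit`
inline (`isOVYLimitStateMicro_iff`). [cite: OllaVaradhanYau1993, §4 (A) and Lemma 4.1] -/
def IsOVYLimitStateMicro (σ : ℝ) (a₀ θ₀ : T3 → ℝ) (u₀ : T3 → V3) (T₀ : ℝ) (D : RotorDie K) (Ω : ℝ)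
    (Ψ : (N : ℕ) → DicedHardSphereFlow (Torus.geometry (Fin 3)) (hsDiameter σ N) (N + 1) D
      (Ω / hsDiameter σ N))
    (μ : Measure (PointConfig (Phase K))) : Prop :=
  ∃ κ : ℕ → ℕ, StrictMono κ ∧ ∀ f : Phase K → ℝ, Continuous f → HasCompactSupport f →
    (∀ p, 0 ≤ f p) →
      Tendsto (fun n => ovyLaplace σ a₀ θ₀ u₀ T₀ (κ n) D (Ω / hsDiameter σ (κ n)) (Ψ (κ n)) f) atTop
        (𝓝 (PointProcess.laplaceFunctional μ f))

/-- `IsOVYLimitStateMicro` is, symbol for symbol, the Laplace-functional clause inlined in the route's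
typed items. [folklore] -/
theorem isOVYLimitStateMicro_iff (σ : ℝ) (a₀ θ₀ : T3 → ℝ) (u₀ : T3 → V3) (T₀ : ℝ) (D : RotorDie K)
    (Ω : ℝ)
    (Ψ : (N : ℕ) → DicedHardSphereFlow (Torus.geometry (Fin 3)) (hsDiameter σ N) (N + 1) D
      (Ω / hsDiameter σ N))
    (μ : Measure (PointConfig (Phase K))) :
    IsOVYLimitStateMicro σ a₀ θ₀ u₀ T₀ D Ω Ψ μ ↔
      ∃ κ : ℕ → ℕ, StrictMono κ ∧ ∀ f : Phase K → ℝ, Continuous f → HasCompactSupport f →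
        (∀ p, 0 ≤ f p) →
          Filter.Tendsto (fun n => ovyLaplace σ a₀ θ₀ u₀ T₀ (κ n) D (Ω / hsDiameter σ (κ n)) (Ψ (κ n)) f)
            Filter.atTop (nhds (PointProcess.laplaceFunctional μ f)) :=
  Iff.rfl

end OVYMicro

namespace InfiniteDicedFlow

local notation "E²" => EuclideanSpace ℝ (Fin 2)
local notation "E³" => EuclideanSpace ℝ (Fin 3)

variable {K : Type*} [MeasurableSpace K] [TopologicalSpace K] {ε Ω : ℝ} {D : RotorDie K}

/-- The particle `p` of the configuration `ω` collides again after time `0` along the diced flow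
`Φ`. [folklore] -/
def HasNextCollision (Φ : InfiniteDicedFlow ε D Ω) (ω : PointConfig (Phase K)) (p : Phase K) : Prop :=
  TaggedParticle.HasNextCollision ε (ω : Set (Phase K)) (Φ.traj ω) p

/-- The next collision time of the particle `p` of `ω` along `Φ`. [folklore] -/
def nextCollisionTime (Φ : InfiniteDicedFlow ε D Ω) (ω : PointConfig (Phase K)) (p : Phase K) : ℝ :=
  TaggedParticle.nextCollisionTime ε (ω : Set (Phase K)) (Φ.traj ω) p

/-- The partner of `p`'s next collision along `Φ`. [folklore] -/
def nextPartner (Φ : InfiniteDicedFlow ε D Ω) (ω : PointConfig (Phase K)) (p : Phase K) : Phase K :=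
  TaggedParticle.nextPartner ε (ω : Set (Phase K)) (Φ.traj ω) p

/-- The OUTGOING LAMBERT POINT of `p`'s next collision along `Φ` (the next-collision outcome of
request D4). [folklore] -/
def nextLambertPoint (Φ : InfiniteDicedFlow ε D Ω) (ω : PointConfig (Phase K)) (p : Phase K) : E² :=
  TaggedParticle.nextLambertPoint ε (ω : Set (Phase K)) (Φ.traj ω) Prod.fst p

omit [MeasurableSpace K] [TopologicalSpace K] in
/-- Collision events of the rotor gas are the collision times, particle by particle. [folklore] -/
theorem mem_collisionEvents_iff {S : Set (Phase K)} {x : Phase K → ℝ → Phase K} {p : Phase K} {t : ℝ} :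
    (p, t) ∈ collisionEvents ε S x ↔ p ∈ S ∧ t ∈ TaggedParticle.collisionTimes ε S x p :=
  Iff.rfl

/-- Along the diced flow, a particle of a good configuration has finitely many collisions in every
bounded time interval `[0, b]` (its continuous path stays in a bounded region, where collision
events are finitely many). [folklore] -/
theorem finite_collisionTimes_inter_Icc (Φ : InfiniteDicedFlow ε D Ω) {ω : PointConfig (Phase K)}
    (hω : ω ∈ Φ.good) {p : Phase K} (hp : p ∈ ω) (a b : ℝ) :
    (TaggedParticle.collisionTimes ε (ω : Set (Phase K)) (Φ.traj ω) p ∩ Icc a b).Finite := by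
  have hT := Φ.isTrajectory ω hω
  -- the path of `p` on `[a, b]` is bounded
  obtain ⟨r, hr⟩ : ∃ r, ∀ t ∈ Icc a b, ‖(Φ.traj ω p t).1‖ ≤ r :=
    isCompact_Icc.exists_bound_of_continuousOn (hT.pos_continuous p hp).continuousOn
  have hfin := hT.locFinite r a b
  have hsub : (fun t => (p, t)) '' (TaggedParticle.collisionTimes ε (ω : Set (Phase K)) (Φ.traj ω) p ∩
      Icc a b) ⊆ collisionEvents ε (ω : Set (Phase K)) (Φ.traj ω) ∩
        {e | ‖(Φ.traj ω e.1 e.2).1‖ ≤ r ∧ e.2 ∈ Icc a b} := by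
    rintro _ ⟨t, ⟨ht, htI⟩, rfl⟩
    exact ⟨⟨hp, ht⟩, hr t htI, htI⟩
  exact (hfin.subset hsub).of_finite_image (fun t _ t' _ h => (Prod.ext_iff.1 h).2)

/-- In particular the collision times in `(0, b]` are finitely many. [folklore] -/
theorem finite_collisionTimes_inter_Ioc (Φ : InfiniteDicedFlow ε D Ω) {ω : PointConfig (Phase K)}
    (hω : ω ∈ Φ.good) {p : Phase K} (hp : p ∈ ω) (b : ℝ) :
    (TaggedParticle.collisionTimes ε (ω : Set (Phase K)) (Φ.traj ω) p ∩ Ioc 0 b).Finite :=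
  (Φ.finite_collisionTimes_inter_Icc hω hp 0 b).subset
    (inter_subset_inter_right _ Ioc_subset_Icc_self)

variable {Φ : InfiniteDicedFlow ε D Ω} {ω : PointConfig (Phase K)} {p : Phase K}

/-- The next collision time of a colliding particle is a positive collision time. [folklore] -/
theorem nextCollisionTime_mem (hω : ω ∈ Φ.good) (hp : p ∈ ω) (h : Φ.HasNextCollision ω p) :
    0 < Φ.nextCollisionTime ω p ∧
      Φ.nextCollisionTime ω p ∈ TaggedParticle.collisionTimes ε (ω : Set (Phase K)) (Φ.traj ω) p :=
  ⟨(TaggedParticle.nextCollisionTime_mem (Φ.finite_collisionTimes_inter_Ioc hω hp) h).2,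
    (TaggedParticle.nextCollisionTime_mem (Φ.finite_collisionTimes_inter_Ioc hω hp) h).1⟩

/-- The partner of the next collision is another particle of `ω`, in contact with `p` at the next
collision time. [folklore] -/
theorem nextPartner_spec (hω : ω ∈ Φ.good) (hp : p ∈ ω) (h : Φ.HasNextCollision ω p) :
    Φ.nextPartner ω p ∈ ω ∧ Φ.nextPartner ω p ≠ p ∧
      ‖(Φ.traj ω p (Φ.nextCollisionTime ω p)).1 -
        (Φ.traj ω (Φ.nextPartner ω p) (Φ.nextCollisionTime ω p)).1‖ = ε :=
  TaggedParticle.nextPartner_spec (Φ.finite_collisionTimes_inter_Ioc hω hp) h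

/-- The partner is the ONLY particle touching `p` at the next collision time (collisions of the
diced flow are pairwise). [folklore] -/
theorem eq_nextPartner (hω : ω ∈ Φ.good) (hp : p ∈ ω) (h : Φ.HasNextCollision ω p) {q : Phase K}
    (hq : q ∈ ω) (hqp : q ≠ p)
    (hcontact : ‖(Φ.traj ω p (Φ.nextCollisionTime ω p)).1 -
      (Φ.traj ω q (Φ.nextCollisionTime ω p)).1‖ = ε) :
    q = Φ.nextPartner ω p := by
  refine TaggedParticle.eq_nextPartner (Φ.finite_collisionTimes_inter_Ioc hω hp) h ?_ hq hqp hcontact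
  intro t q₁ hq₁ hq₁p hq₁c q' hq' hq'p hq'c
  have h1 := ((Φ.isTrajectory ω hω).binary p hp q₁ hq₁ (Ne.symm hq₁p) t hq₁c).1
  exact h1 q' hq' hq'p hq'c

/-- The outgoing Lambert point of a next collision lies in the closed unit disc (`ε > 0`).
[folklore] -/
theorem norm_nextLambertPoint_le_one (hω : ω ∈ Φ.good) (hp : p ∈ ω) (h : Φ.HasNextCollision ω p)
    (hε : 0 < ε) : ‖Φ.nextLambertPoint ω p‖ ≤ 1 :=
  TaggedParticle.norm_nextLambertPoint_le_one _ (Φ.finite_collisionTimes_inter_Ioc hω hp) h hε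

variable [OpensMeasurableSpace K] [T2Space K] [SigmaCompactSpace K]

variable (Φ) in
/-- **The one-sphere Hopf property (H) of the law `μ` under the diced flow `Φ`** (request D4; the
hypothesis of crux `OneSphereHopfToMaxwellian`, the conclusion of `SpecularDiceHopf` for the trivial
die): for a `μ`-typical configuration `ω` and a typical particle `p ∈ ω` that collides again after
time `0`, CONDITIONALLY ON EVERYTHING ELSE — the other particles' positions, velocities and rotors,
`p`'s position and `p`'s speed — the law of the outgoing Lambert point of `p`'s next collision is
absolutely continuous with respect to area measure on the closed unit Lambert disc of `ℝ²`
(`TaggedParticle.lambertDiscMeasure`): the joint law of (everything else, outcome) under the Campbell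
measure, restricted to colliding particles, is `≪ (law of everything else) ⊗ Leb_disc`
(`PointProcess.HasAbsContOutcome`). [folklore] -/
def HasOneSphereHopfProperty (μ : Measure (PointConfig (Phase K))) : Prop :=
  PointProcess.HasAbsContOutcome μ (TaggedParticle.everythingElse (V := E³) (Prod.fst : E³ × K → E³))
    {z | Φ.HasNextCollision z.1 z.2} (fun z => Φ.nextLambertPoint z.1 z.2)
    TaggedParticle.lambertDiscMeasure

/-- Unfolding lemma for the one-sphere Hopf property. [folklore] -/
theorem hasOneSphereHopfProperty_iff (μ : Measure (PointConfig (Phase K))) :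
    Φ.HasOneSphereHopfProperty μ ↔
      ∀ S : Set ((PointConfig (Phase K) × E³ × ℝ) × E²), MeasurableSet S →
        ((PointProcess.campbellMeasure μ).map
            (TaggedParticle.everythingElse (V := E³) (Prod.fst : E³ × K → E³))).prod
          TaggedParticle.lambertDiscMeasure S = 0 →
        PointProcess.campbellMeasure μ ({z | Φ.HasNextCollision z.1 z.2} ∩
          (fun z => (TaggedParticle.everythingElse (V := E³) (Prod.fst : E³ × K → E³) z,
            Φ.nextLambertPoint z.1 z.2)) ⁻¹' S) = 0 :=
  Iff.rfl

/-- The empty state (no particle at all) has property (H): there is nothing to require — a sanity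
check of the junk-free direction of the definition (the requirement bears on colliding particles
only). [folklore] -/
theorem hasOneSphereHopfProperty_dirac_empty (Φ : InfiniteDicedFlow ε D Ω) :
    Φ.HasOneSphereHopfProperty (Measure.dirac ∅) :=
  PointProcess.hasAbsContOutcome_of_null (by
    rw [PointProcess.campbellMeasure_dirac_empty, Measure.coe_zero, Pi.zero_apply])

omit [SigmaCompactSpace K] in
/-- The conditioning of (H) is a genuine (measurable) statistic of `(ω, p)`. [folklore] -/
theorem measurable_everythingElse [SecondCountableTopology K] :
    Measurable (TaggedParticle.everythingElse (V := E³) (Prod.fst : E³ × K → E³)) :=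
  PointProcess.measurable_everythingElse measurable_fst

/-- WITH MEASURABLE NEXT-COLLISION DATA — an extra hypothesis, not provable from the flow structure,
whose tracking map `traj` carries no measurability axiom — (H) is literally Mathlib's absolute
continuity `(C|_{τ⁺ < ⊤}).map (everything else, outcome) ≪ (C.map everything else) ⊗ Leb_disc`, `C`
the Campbell measure of `μ`. [folklore] -/
theorem hasOneSphereHopfProperty_iff_map [SecondCountableTopology K] {μ : Measure (PointConfig (Phase K))}
    (hO : Measurable fun z : PointConfig (Phase K) × Phase K => Φ.nextLambertPoint z.1 z.2) :
    Φ.HasOneSphereHopfProperty μ ↔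
      ((PointProcess.campbellMeasure μ).restrict {z | Φ.HasNextCollision z.1 z.2}).map
          (fun z => (TaggedParticle.everythingElse (V := E³) (Prod.fst : E³ × K → E³) z,
            Φ.nextLambertPoint z.1 z.2)) ≪
        ((PointProcess.campbellMeasure μ).map
          (TaggedParticle.everythingElse (V := E³) (Prod.fst : E³ × K → E³))).prod
          TaggedParticle.lambertDiscMeasure :=
  PointProcess.hasAbsContOutcome_iff_map measurable_everythingElse hO

end InfiniteDicedFlow

end RotorGas

/-! ## The one-sphere Hopf property of the true hard-sphere gas (Alexander's flow, `d = 3`) -/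

section HardSphereGas

variable {d : Type*} [Fintype d] {ε : ℝ}

local notation "𝔼" => EuclideanSpace ℝ d

/-- The particle `p` of `ω` collides again after time `0` along Alexander's flow `Φ` (dot-notation
extension of the `FluidPDE` structure, declared here with the kinetic-theory notions it serves).
[folklore] -/
def _root_.Literature.Analysis.FluidPDE.InfiniteHardSphereFlow.HasNextCollision
    (Φ : InfiniteHardSphereFlow d ε) (ω : PointConfig (𝔼 × 𝔼)) (p : 𝔼 × 𝔼) : Prop :=
  TaggedParticle.HasNextCollision ε (ω : Set (𝔼 × 𝔼)) (Φ.traj ω) p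

/-- The next collision time of `p` along `Φ`. [folklore] -/
def _root_.Literature.Analysis.FluidPDE.InfiniteHardSphereFlow.nextCollisionTime
    (Φ : InfiniteHardSphereFlow d ε) (ω : PointConfig (𝔼 × 𝔼)) (p : 𝔼 × 𝔼) : ℝ :=
  TaggedParticle.nextCollisionTime ε (ω : Set (𝔼 × 𝔼)) (Φ.traj ω) p

/-- The partner of `p`'s next collision along `Φ`. [folklore] -/
def _root_.Literature.Analysis.FluidPDE.InfiniteHardSphereFlow.nextPartner
    (Φ : InfiniteHardSphereFlow d ε) (ω : PointConfig (𝔼 × 𝔼)) (p : 𝔼 × 𝔼) : 𝔼 × 𝔼 :=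
  TaggedParticle.nextPartner ε (ω : Set (𝔼 × 𝔼)) (Φ.traj ω) p

/-- Collision events of the hard-sphere gas are the collision times, particle by particle.
[folklore] -/
theorem mem_collisionEvents_iff {S : Set (𝔼 × 𝔼)} {x : 𝔼 × 𝔼 → ℝ → 𝔼 × 𝔼} {p : 𝔼 × 𝔼} {t : ℝ} :
    (p, t) ∈ Literature.Analysis.FluidPDE.collisionEvents ε S x ↔ p ∈ S ∧ t ∈ TaggedParticle.collisionTimes ε S x p :=
  Iff.rfl

/-- Along Alexander's flow a particle of a good configuration has finitely many collisions during
`[a, b]`. [folklore] -/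
theorem _root_.Literature.Analysis.FluidPDE.InfiniteHardSphereFlow.finite_collisionTimes_inter_Icc
    (Φ : InfiniteHardSphereFlow d ε) {ω : PointConfig (𝔼 × 𝔼)} (hω : ω ∈ Φ.good) {p : 𝔼 × 𝔼}
    (hp : p ∈ ω) (a b : ℝ) :
    (TaggedParticle.collisionTimes ε (ω : Set (𝔼 × 𝔼)) (Φ.traj ω) p ∩ Icc a b).Finite := by
  have hT := Φ.isTrajectory ω hω
  obtain ⟨r, hr⟩ : ∃ r, ∀ t ∈ Icc a b, ‖(Φ.traj ω p t).1‖ ≤ r :=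
    isCompact_Icc.exists_bound_of_continuousOn (hT.pos_continuous p hp).continuousOn
  have hfin := hT.locFinite r a b
  have hsub : (fun t => (p, t)) '' (TaggedParticle.collisionTimes ε (ω : Set (𝔼 × 𝔼)) (Φ.traj ω) p ∩
      Icc a b) ⊆ Literature.Analysis.FluidPDE.collisionEvents ε (ω : Set (𝔼 × 𝔼)) (Φ.traj ω) ∩
        {e | ‖(Φ.traj ω e.1 e.2).1‖ ≤ r ∧ e.2 ∈ Icc a b} := by
    rintro _ ⟨t, ⟨ht, htI⟩, rfl⟩
    exact ⟨⟨hp, ht⟩, hr t htI, htI⟩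
  exact (hfin.subset hsub).of_finite_image (fun t _ t' _ h => (Prod.ext_iff.1 h).2)

/-- In particular the collision times in `(0, b]` are finitely many. [folklore] -/
theorem _root_.Literature.Analysis.FluidPDE.InfiniteHardSphereFlow.finite_collisionTimes_inter_Ioc
    (Φ : InfiniteHardSphereFlow d ε) {ω : PointConfig (𝔼 × 𝔼)} (hω : ω ∈ Φ.good) {p : 𝔼 × 𝔼}
    (hp : p ∈ ω) (b : ℝ) :
    (TaggedParticle.collisionTimes ε (ω : Set (𝔼 × 𝔼)) (Φ.traj ω) p ∩ Ioc 0 b).Finite :=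
  (Φ.finite_collisionTimes_inter_Icc hω hp 0 b).subset
    (inter_subset_inter_right _ Ioc_subset_Icc_self)

section NextCollision

-- (no local notation inside `variable` binders: it does not survive re-elaboration)
variable {Φ : InfiniteHardSphereFlow d ε} {ω : PointConfig (EuclideanSpace ℝ d × EuclideanSpace ℝ d)}
  {p : EuclideanSpace ℝ d × EuclideanSpace ℝ d}

/-- The next collision time of a colliding particle is a positive collision time. [folklore] -/
theorem _root_.Literature.Analysis.FluidPDE.InfiniteHardSphereFlow.nextCollisionTime_mem
    (hω : ω ∈ Φ.good) (hp : p ∈ ω) (h : Φ.HasNextCollision ω p) :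
    0 < Φ.nextCollisionTime ω p ∧
      Φ.nextCollisionTime ω p ∈ TaggedParticle.collisionTimes ε (ω : Set (𝔼 × 𝔼)) (Φ.traj ω) p :=
  ⟨(TaggedParticle.nextCollisionTime_mem (Φ.finite_collisionTimes_inter_Ioc hω hp) h).2,
    (TaggedParticle.nextCollisionTime_mem (Φ.finite_collisionTimes_inter_Ioc hω hp) h).1⟩

/-- The partner of the next collision is another particle of `ω` in contact with `p`. [folklore] -/
theorem _root_.Literature.Analysis.FluidPDE.InfiniteHardSphereFlow.nextPartner_spec
    (hω : ω ∈ Φ.good) (hp : p ∈ ω) (h : Φ.HasNextCollision ω p) :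
    Φ.nextPartner ω p ∈ ω ∧ Φ.nextPartner ω p ≠ p ∧
      ‖(Φ.traj ω p (Φ.nextCollisionTime ω p)).1 -
        (Φ.traj ω (Φ.nextPartner ω p) (Φ.nextCollisionTime ω p)).1‖ = ε :=
  TaggedParticle.nextPartner_spec (Φ.finite_collisionTimes_inter_Ioc hω hp) h

/-- The partner is the ONLY particle touching `p` at the next collision time (collisions of the
hard-sphere flow are pairwise). [folklore] -/
theorem _root_.Literature.Analysis.FluidPDE.InfiniteHardSphereFlow.eq_nextPartner
    (hω : ω ∈ Φ.good) (hp : p ∈ ω) (h : Φ.HasNextCollision ω p) {q : 𝔼 × 𝔼} (hq : q ∈ ω)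
    (hqp : q ≠ p)
    (hcontact : ‖(Φ.traj ω p (Φ.nextCollisionTime ω p)).1 -
      (Φ.traj ω q (Φ.nextCollisionTime ω p)).1‖ = ε) :
    q = Φ.nextPartner ω p := by
  refine TaggedParticle.eq_nextPartner (Φ.finite_collisionTimes_inter_Ioc hω hp) h ?_ hq hqp hcontact
  intro t q₁ hq₁ hq₁p hq₁c q' hq' hq'p hq'c
  exact ((Φ.isTrajectory ω hω).binary p hp q₁ hq₁ (Ne.symm hq₁p) t hq₁c).1 q' hq' hq'p hq'c

end NextCollision

end HardSphereGas

section HardSphereGas3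

local notation "E²" => EuclideanSpace ℝ (Fin 2)
local notation "E³" => EuclideanSpace ℝ (Fin 3)

variable {ε : ℝ}

/-- The OUTGOING LAMBERT POINT of `p`'s next collision along Alexander's flow in `ℝ³` (velocity =
the mark itself). For the elastic law it equals the incoming Lambert point (`Λ_n` forgets the
normal component, which is all the specular reflection changes). [folklore] -/
def _root_.Literature.Analysis.FluidPDE.InfiniteHardSphereFlow.nextLambertPoint
    (Φ : InfiniteHardSphereFlow (Fin 3) ε) (ω : PointConfig (E³ × E³)) (p : E³ × E³) : E² :=
  TaggedParticle.nextLambertPoint ε (ω : Set (E³ × E³)) (Φ.traj ω) id p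

/-- LAMBERT'S PROJECTION DOES NOT SEE THE ELASTIC REFLECTION: for the elastic law `reflectVel n` the
outgoing relative velocity `v' - w' = g - 2 (⟪g, n⟫/‖n‖²) n` has the same speed and the same Lambert
point over any normal `c • n` as the incoming one `g = v - w` (`Λ` forgets the normal component,
`Lambert.coords_sub_smul_self`). [folklore] -/
theorem lambertPoint_reflectVel_fst_sub_snd {n : E³} (hn : n ≠ 0) {c : ℝ} (hc : c ≠ 0) (P : E³ × E³) :
    lambertPoint (c • n) ((reflectVel n P).1 - (reflectVel n P).2) = lambertPoint (c • n) (P.1 - P.2) := by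
  set g : E³ := P.1 - P.2 with hg
  set k : ℝ := ⟪P.1 - P.2, n⟫_ℝ / ‖n‖ ^ 2 with hk
  have hn' : ‖n‖ ≠ 0 := norm_ne_zero_iff.2 hn
  have hkn : k * ‖n‖ ^ 2 = ⟪g, n⟫_ℝ := by
    rw [hk, hg]
    field_simp
  have hout : (reflectVel n P).1 - (reflectVel n P).2 = g - (2 * k) • n := by
    simp only [reflectVel, hg, hk]
    module
  have hnorm : ‖g - (2 * k) • n‖ = ‖g‖ := by
    have h2 : ‖g - (2 * k) • n‖ ^ 2 = ‖g‖ ^ 2 := by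
      rw [norm_sub_sq_real, real_inner_smul_right, norm_smul, mul_pow, Real.norm_eq_abs, sq_abs]
      linear_combination (4 * k) * hkn
    exact (pow_left_inj₀ (norm_nonneg _) (norm_nonneg _) two_ne_zero).1 h2
  have hcoords : Lambert.coords (c • n) (g - (2 * k) • n) = Lambert.coords (c • n) g := by
    have : (2 * k) • n = (2 * k / c) • (c • n) := by
      rw [smul_smul, div_mul_cancel₀ _ hc]
    rw [this, Lambert.coords_sub_smul_self]
  rw [hout, lambertPoint, lambertPoint, hnorm, hcoords]

/-- **For the true gas the outgoing Lambert point is the Lambert point of the INCOMING relative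
velocity.** Along Alexander's flow, at the next collision of `p` (time `τ`, partner `q`, incoming
velocities the left limits `v_p⁻, v_q⁻`, `⟪x_p - x_q, v_p⁻ - v_q⁻⟫ < 0`) the outgoing Lambert point
`Φ.nextLambertPoint ω p` equals `lambertPoint n (v_p⁻ - v_q⁻)`, `n` the unit normal towards `p`: so
for `F ≡ id` property (H) is a statement about the conditional law of the direction of the
INCOMING relative velocity of the next collision in the frame of its normal (the impact geometry).
[folklore] -/
theorem _root_.Literature.Analysis.FluidPDE.InfiniteHardSphereFlow.nextLambertPoint_eq_incoming
    {Φ : InfiniteHardSphereFlow (Fin 3) ε} {ω : PointConfig (E³ × E³)} {p : E³ × E³}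
    (hω : ω ∈ Φ.good) (hp : p ∈ ω) (h : Φ.HasNextCollision ω p) (hε : 0 < ε) :
    ∃ vp vq : E³,
      Tendsto (fun s => (Φ.traj ω p s).2) (𝓝[<] (Φ.nextCollisionTime ω p)) (𝓝 vp) ∧
      Tendsto (fun s => (Φ.traj ω (Φ.nextPartner ω p) s).2) (𝓝[<] (Φ.nextCollisionTime ω p)) (𝓝 vq) ∧
      ⟪(Φ.traj ω p (Φ.nextCollisionTime ω p)).1 -
        (Φ.traj ω (Φ.nextPartner ω p) (Φ.nextCollisionTime ω p)).1, vp - vq⟫_ℝ < 0 ∧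
      Φ.nextLambertPoint ω p =
        lambertPoint (TaggedParticle.nextNormal ε (ω : Set (E³ × E³)) (Φ.traj ω) p) (vp - vq) := by
  obtain ⟨hq, hqp, hcontact⟩ := Φ.nextPartner_spec hω hp h
  set τ := Φ.nextCollisionTime ω p with hτ
  set q := Φ.nextPartner ω p with hqdef
  have hT := Φ.isTrajectory ω hω
  obtain ⟨-, vp, vq, hvp, hvq, hin, hvp'⟩ := hT.binary p hp q hq (Ne.symm hqp) τ hcontact
  have hcontact' : ‖(Φ.traj ω q τ).1 - (Φ.traj ω p τ).1‖ = ε := by rw [norm_sub_rev, hcontact]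
  obtain ⟨-, vq', vp', hvq', hvp'', -, hvq2⟩ := hT.binary q hq p hp hqp τ hcontact'
  have evq : vq = vq' := tendsto_nhds_unique hvq hvq'
  have evp : vp = vp' := tendsto_nhds_unique hvp hvp''
  subst evq evp
  set n : E³ := (Φ.traj ω p τ).1 - (Φ.traj ω q τ).1 with hn
  have hn0 : n ≠ 0 := by
    intro h0
    rw [h0, norm_zero] at hcontact
    exact hε.ne' hcontact.symm
  -- the partner's outgoing velocity is the second component of the same elastic pair computation
  have hvq2' : (Φ.traj ω q τ).2 = (reflectVel n (vp, vq)).2 := by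
    have hneg : (Φ.traj ω q τ).1 - (Φ.traj ω p τ).1 = (-1 : ℝ) • n := by
      rw [hn, neg_one_smul, neg_sub]
    rw [RotorGas.reflectVel_swap_snd, hvq2, hneg, reflectVel_smul (by norm_num : (-1 : ℝ) ≠ 0)]
  refine ⟨vp, vq, hvp, hvq, hin, ?_⟩
  change lambertPoint (ε⁻¹ • n) ((Φ.traj ω p τ).2 - (Φ.traj ω q τ).2) = lambertPoint (ε⁻¹ • n) (vp - vq)
  rw [hvp', hvq2']
  exact lambertPoint_reflectVel_fst_sub_snd hn0 (inv_ne_zero hε.ne') (vp, vq)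

/-- The outgoing Lambert point of a next collision lies in the closed unit disc. [folklore] -/
theorem _root_.Literature.Analysis.FluidPDE.InfiniteHardSphereFlow.norm_nextLambertPoint_le_one
    {Φ : InfiniteHardSphereFlow (Fin 3) ε} {ω : PointConfig (E³ × E³)} {p : E³ × E³}
    (hω : ω ∈ Φ.good) (hp : p ∈ ω) (h : Φ.HasNextCollision ω p) (hε : 0 < ε) :
    ‖Φ.nextLambertPoint ω p‖ ≤ 1 :=
  TaggedParticle.norm_nextLambertPoint_le_one _ (Φ.finite_collisionTimes_inter_Ioc hω hp) h hε

/-- **The one-sphere Hopf property (H) of the law `μ` under Alexander's hard-sphere flow `Φ` in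
`ℝ³`** (request D4; the conclusion of crux `SpecularDiceHopf`): for a `μ`-typical configuration and
a typical particle `p` that collides again after time `0`, conditionally on everything else — the
other particles' positions and velocities, `p`'s position and speed — the law of the outgoing
Lambert point of `p`'s next collision (= the Lambert point of the INCOMING relative velocity,
`nextLambertPoint_eq_incoming`) is absolutely continuous with respect to area measure on the closed
unit Lambert disc (`PointProcess.HasAbsContOutcome` under the Campbell measure, reference measure
`TaggedParticle.lambertDiscMeasure`). [folklore] -/
def _root_.Literature.Analysis.FluidPDE.InfiniteHardSphereFlow.HasOneSphereHopfProperty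
    (Φ : InfiniteHardSphereFlow (Fin 3) ε) (μ : Measure (PointConfig (E³ × E³))) : Prop :=
  PointProcess.HasAbsContOutcome μ (TaggedParticle.everythingElse (V := E³) (id : E³ → E³))
    {z | Φ.HasNextCollision z.1 z.2} (fun z => Φ.nextLambertPoint z.1 z.2)
    TaggedParticle.lambertDiscMeasure

/-- Unfolding lemma for the one-sphere Hopf property of the true gas. [folklore] -/
theorem _root_.Literature.Analysis.FluidPDE.InfiniteHardSphereFlow.hasOneSphereHopfProperty_iff
    (Φ : InfiniteHardSphereFlow (Fin 3) ε) (μ : Measure (PointConfig (E³ × E³))) :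
    Φ.HasOneSphereHopfProperty μ ↔
      ∀ S : Set ((PointConfig (E³ × E³) × E³ × ℝ) × E²), MeasurableSet S →
        ((PointProcess.campbellMeasure μ).map
            (TaggedParticle.everythingElse (V := E³) (id : E³ → E³))).prod
          TaggedParticle.lambertDiscMeasure S = 0 →
        PointProcess.campbellMeasure μ ({z | Φ.HasNextCollision z.1 z.2} ∩
          (fun z => (TaggedParticle.everythingElse (V := E³) (id : E³ → E³) z,
            Φ.nextLambertPoint z.1 z.2)) ⁻¹' S) = 0 :=
  Iff.rfl

/-- The empty state has property (H) under Alexander's flow (nothing to require). [folklore] -/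
theorem _root_.Literature.Analysis.FluidPDE.InfiniteHardSphereFlow.hasOneSphereHopfProperty_dirac_empty
    (Φ : InfiniteHardSphereFlow (Fin 3) ε) : Φ.HasOneSphereHopfProperty (Measure.dirac ∅) :=
  PointProcess.hasAbsContOutcome_of_null (by
    rw [PointProcess.campbellMeasure_dirac_empty, Measure.coe_zero, Pi.zero_apply])

/-- The conditioning of (H) for the true gas is measurable in `(ω, p)`. [folklore] -/
theorem measurable_everythingElse_id :
    Measurable (TaggedParticle.everythingElse (V := E³) (id : E³ → E³)) :=
  PointProcess.measurable_everythingElse measurable_id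

/-- With measurable next-collision data (an extra hypothesis, see the rotor-gas version), (H) for
the true gas is Mathlib's absolute continuity of the joint law. [folklore] -/
theorem _root_.Literature.Analysis.FluidPDE.InfiniteHardSphereFlow.hasOneSphereHopfProperty_iff_map
    {Φ : InfiniteHardSphereFlow (Fin 3) ε} {μ : Measure (PointConfig (E³ × E³))}
    (hO : Measurable fun z : PointConfig (E³ × E³) × (E³ × E³) => Φ.nextLambertPoint z.1 z.2) :
    Φ.HasOneSphereHopfProperty μ ↔
      ((PointProcess.campbellMeasure μ).restrict {z | Φ.HasNextCollision z.1 z.2}).map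
          (fun z => (TaggedParticle.everythingElse (V := E³) (id : E³ → E³) z,
            Φ.nextLambertPoint z.1 z.2)) ≪
        ((PointProcess.campbellMeasure μ).map
          (TaggedParticle.everythingElse (V := E³) (id : E³ → E³))).prod
          TaggedParticle.lambertDiscMeasure :=
  PointProcess.hasAbsContOutcome_iff_map measurable_everythingElse_id hO

end HardSphereGas3

/-! ## The rotor die of an Anosov die -/

/-- The ROTOR-DIE DATA of an Anosov die: `(m, g, F, ι)` read off the interface `AnosovDie` (what the
items `RotorGasMacroErgodic`, `RotorGasEulerLimit`, `DicedDynamicsExist` inline as `Dr = ⟨D.m, D.flow,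
fun θ θ' p => D.die θ θ' p, D.rev⟩`; dot-notation extension of the `Dynamics/Hyperbolic` structure).
[folklore] -/
def _root_.Literature.Dynamics.Hyperbolic.AnosovDie.toRotorDie (D : Literature.Dynamics.Hyperbolic.AnosovDie) :
    RotorDie D.K :=
  ⟨D.m, D.flow, fun θ θ' p => D.die θ θ' p, D.rev⟩

namespace AnosovDieAPI

variable (D : Literature.Dynamics.Hyperbolic.AnosovDie)

/-- `toRotorDie` is the inlined record of the route items. [folklore] -/
theorem toRotorDie_eq :
    D.toRotorDie = (RotorDie.mk D.m D.flow (fun θ θ' p => D.die θ θ' p) D.rev : RotorDie D.K) :=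
  rfl

/-- The rotor reference measure of `toRotorDie` is `D.m`. [folklore] -/
@[simp] theorem toRotorDie_m : D.toRotorDie.m = D.m := rfl

/-- The rotor flow of `toRotorDie` is `D.flow`. [folklore] -/
@[simp] theorem toRotorDie_g : D.toRotorDie.g = D.flow := rfl

/-- The die of `toRotorDie` is `D.die`. [folklore] -/
@[simp] theorem toRotorDie_F (θ θ' : D.K) (p : EuclideanSpace ℝ (Fin 2)) :
    D.toRotorDie.F θ θ' p = D.die θ θ' p := rfl

/-- The rotor involution of `toRotorDie` is `D.rev`. [folklore] -/
@[simp] theorem toRotorDie_ι : D.toRotorDie.ι = D.rev := rfl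

/-- The rotor die of an Anosov die satisfies the REVERSIBILITY CLAUSE of `DicedHardSphereDynamics`
(`ι` an involution reversing the rotor flow, `F (ι θ) (ι θ') (-(F θ θ' q)) = -q`), from the fields
`rev_rev`, `rev_flow`, `die_rev` of the interface. [folklore] -/
theorem toRotorDie_isReversible : D.toRotorDie.IsReversible where
  ι_ι := D.rev_rev
  ι_g := D.rev_flow
  F_rev θ θ' q _ := by
    change D.die (D.rev θ) (D.rev θ') (-(D.die θ θ' q)) = -q
    rw [D.die_rev, neg_neg, Equiv.symm_apply_apply]

end AnosovDieAPI

end Literature.MathematicalPhysics.KineticTheory
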